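import Summits.Ventures.YMGap.Thresholds.PressureZeroCoupling
import Summits.Ventures.YMGap.Thresholds.CouplingSignFlip
import HarnessLib

/-!
# The two-sided strong-coupling window `|β_W| ≤ 9/25` of `SU(2)`: the free energy density is `C¹` THROUGH `β = 0`
# with `f'(0) = -12` and `f''(0) = 6` (row type C-PRESS, part 7)

Cell `pub-ymgap`, seat ds-1 (gen 9). HONEST FRAMING: strong-coupling LATTICE statements for `SU(2)` Wilson lattice gauge theory on
`ℤ⁴` on the TWO-SIDED one-state window `|β| ≤ 9/50` (tree coupling; Wilson `|β_W| ≤ 9/25`); `C¹` and a second derivative at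
`β = 0` — NOT analyticity; nothing about the continuum or the Clay problem. Kernel theorems only, 0 compute.

Mechanism: the coupling-sign symmetry of `SU(2)` (staggered centre flip, ds-3's `CouplingSignFlip.lean`: `isGibbsMeasure_map_flip`,
`plaquetteObs_flip`, `hasUniqueGibbsMeasure_neg`) transports uniqueness to negative couplings and makes the mean plaquette ODD in
`β` (`su2_integral_plaquetteObs_neg`); with `u(0) = 0` (part 4) the energy density of THE state is continuous on `[-9/50, 9/50]`
(`su2_continuousOn_plaquette_abs`), so part 1's squeeze gives differentiability on the whole two-sided window
(`su2_hasDerivWithinAt/hasDerivAt_freeEnergyDensity_abs`), in particular ★★ `su2_hasDerivAt_freeEnergyDensity_zero : HasDerivAt f (-12) 0`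
(two-sided; part 4 had the right derivative), `su2_deriv_freeEnergyDensity_eq_abs`, `su2_contDiffOn_one_freeEnergyDensity_abs`
(`f ∈ C¹(-9/50, 9/50)`), the oddness law `su2_deriv_freeEnergyDensity_neg` (`f'(-β) = -24 - f'(β)`), and ★★
`su2_hasDerivAt_deriv_freeEnergyDensity_zero : HasDerivAt (deriv f) 6 0` — the second derivative AT `β = 0` exists two-sidedly and
equals `#planes · N² · Var_Haar(W_p) = 6 · 4 · (1/4)` (right side: part 4's `u'(0⁺) = 1/4`; left side: oddness), i.e. in Wilson's
normalisation `g(β_W) = f(β_W/2) = -6β_W + (3/4)β_W² + o(β_W²)` on BOTH sides of `0`. Part 8 (`PressureTwoSidedC2.lean`)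
adds `(f')'(-β) = (f')'(β)`, `ContDiffOn ℝ 2` on the whole two-sided window and the Wilson-normalised forms.
-/

noncomputable section

open MeasureTheory ProbabilityTheory Set Filter Topology
open scoped NNReal
open Literature.MathematicalPhysics.QuantumLattice (LGConfig ZdEdge ZdPlaquette fundamentalRep ymGibbsMeasures
  ymSpecification plaquetteObs plaquetteEdges freeEnergyDensity IsZdTranslationInvariant continuous_fundamentalRep)
open Literature.MathematicalPhysics.QuantumFieldTheory hiding ZdEdge

namespace Summit.Ventures.YMGap.PressureRegularity

/-! ## F. The two-sided window `|β| ≤ 9/50` of `SU(2)`: coupling-sign symmetry, `C¹` through `β = 0`, `f''(0) = 6` -/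

section TwoSided

open Summit.Ventures.YMGap.SignFlip (flip flipEquiv coe_flipEquiv measurable_flip isGibbsMeasure_map_flip
  plaquetteObs_flip hasUniqueGibbsMeasure_neg)
open Summit.Ventures.YMGap.CouplingResponse (su2_continuousOn_responseSum)

/-- Local shorthand: the planes `{(i, j) : i < j}` of `ℤ⁴`. -/
local notation3 (prettyPrint := false) "𝔓₄" => {q : Fin 4 × Fin 4 // q.1 < q.2}

/-- `SU(2)` is second countable (closed subgroup of `2 × 2` complex matrices). [folklore] -/
private theorem secondCountable_su2_ts : SecondCountableTopology (Matrix.specialUnitaryGroup (Fin 2) ℂ) :=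
  haveI : SecondCountableTopology (Matrix (Fin 2) (Fin 2) ℂ) :=
    inferInstanceAs (SecondCountableTopology (Fin 2 → Fin 2 → ℂ))
  Topology.IsEmbedding.subtypeVal.secondCountableTopology

/-- A DLR selection of `SU(2)` on ALL real tree couplings (`β ↦ μ (2β)` for g8's `β_W`-indexed selection). -/
theorem su2_exists_dlrSelection_tree :
    ∃ ν : ℝ → Measure (LGConfig 4 (Matrix.specialUnitaryGroup (Fin 2) ℂ)),
      ∀ β : ℝ, ν β ∈ ymGibbsMeasures (d := 4) (fundamentalRep (Fin 2)) β := by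
  obtain ⟨μ, hμ⟩ := CouplingResponse.exists_dlrSelection
  refine ⟨fun β => μ (2 * β), fun β => ?_⟩
  have h := hμ (2 * β)
  rwa [show (2 : ℝ) * (2 * β / 4) = β by ring] at h

/-- ★ **Two-sided uniqueness**: `SU(2)`, `d = 4`, ONE DLR state at every tree coupling `|β| ≤ 9/50` (`|β_W| ≤ 9/25`) — the
one-sided window of part 1 transported by the coupling-sign (staggered centre flip) symmetry `SignFlip.hasUniqueGibbsMeasure_neg`. -/
theorem su2_subsingleton_ymGibbsMeasures_abs {β : ℝ} (hβ : |β| ≤ 9 / 50) :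
    (ymGibbsMeasures (d := 4) (fundamentalRep (Fin 2)) β).Subsingleton := by
  rcases le_or_gt 0 β with h0 | h0
  · exact su2_subsingleton_ymGibbsMeasures ⟨h0, by rwa [abs_of_nonneg h0] at hβ⟩
  · have hneg : -β ∈ Icc (0 : ℝ) (9 / 50) := ⟨by linarith, by rw [abs_of_neg h0] at hβ; exact hβ⟩
    obtain ⟨ν, hν⟩ := su2_exists_dlrSelection_tree
    have hu : Literature.Probability.LatticeModels.HasUniqueGibbsMeasure
        (ymSpecification (d := 4) (fundamentalRep (Fin 2)) (-β)) :=
      ⟨su2_subsingleton_ymGibbsMeasures hneg, ⟨ν (-β), hν (-β)⟩⟩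
    have h := hasUniqueGibbsMeasure_neg (d := 4) hu
    rw [neg_neg] at h
    exact h.1

/-- Two-sided translation invariance of THE state. -/
theorem su2_isZdTranslationInvariant_abs {β : ℝ} (hβ : |β| ≤ 9 / 50)
    {ν : Measure (LGConfig 4 (Matrix.specialUnitaryGroup (Fin 2) ℂ))}
    (hν : ν ∈ ymGibbsMeasures (d := 4) (fundamentalRep (Fin 2)) β) : IsZdTranslationInvariant ν :=
  haveI := secondCountable_su2_ts
  isZdTranslationInvariant_of_subsingleton _ (continuous_fundamentalRep _) (su2_subsingleton_ymGibbsMeasures_abs hβ) hν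

/-- ★ **The mean plaquette is ODD in the coupling**: for `|β| ≤ 9/50`, `⟨Re tr U_p⟩_{𝒢(-β)} = -⟨Re tr U_p⟩_{𝒢(β)}` — THE state
at `-β` is the flip image of THE state at `β` (`SignFlip.isGibbsMeasure_map_flip`) and every plaquette flips sign
(`SignFlip.plaquetteObs_flip`). -/
theorem su2_integral_plaquetteObs_neg {β : ℝ} (hβ : |β| ≤ 9 / 50)
    {ν ν' : Measure (LGConfig 4 (Matrix.specialUnitaryGroup (Fin 2) ℂ))}
    (hν : ν ∈ ymGibbsMeasures (d := 4) (fundamentalRep (Fin 2)) (-β))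
    (hν' : ν' ∈ ymGibbsMeasures (d := 4) (fundamentalRep (Fin 2)) β) (p : ZdPlaquette 4) :
    ∫ U, plaquetteObs (fundamentalRep (Fin 2)) p.1 p.2.1.1 p.2.1.2 U ∂ν =
      -∫ U, plaquetteObs (fundamentalRep (Fin 2)) p.1 p.2.1.1 p.2.1.2 U ∂ν' := by
  have h1 : ν'.map flip ∈ ymGibbsMeasures (d := 4) (fundamentalRep (Fin 2)) (-β) :=
    isGibbsMeasure_map_flip (d := 4) hν'
  have h2 : ν = ν'.map flip := su2_subsingleton_ymGibbsMeasures_abs (by rwa [abs_neg]) hν h1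
  rw [h2, ← coe_flipEquiv, integral_map_equiv, ← integral_neg]
  refine integral_congr_ae (ae_of_all _ fun U => ?_)
  simp only [coe_flipEquiv, plaquetteObs_flip U p.1 (ne_of_lt p.2.2)]

/-- **C-LIP on the two-sided window**: along any DLR selection on `[-9/50, 9/50]`, every plaquette expectation is continuous
on `[-9/50, 9/50]` — the right half by C-LIP-STAR (part 1), the left half by oddness, glued at `β = 0` where the plaquette
expectation vanishes (part 4). -/
theorem su2_continuousOn_plaquette_abs
    {μ : ℝ → Measure (LGConfig 4 (Matrix.specialUnitaryGroup (Fin 2) ℂ))}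
    (hμ : ∀ β ∈ Icc (-(9 / 50) : ℝ) (9 / 50), μ β ∈ ymGibbsMeasures (d := 4) (fundamentalRep (Fin 2)) β)
    (p : ZdPlaquette 4) :
    ContinuousOn (fun β => ∫ U, plaquetteObs (fundamentalRep (Fin 2)) p.1 p.2.1.1 p.2.1.2 U ∂(μ β))
      (Icc (-(9 / 50) : ℝ) (9 / 50)) := by
  have hμp : ∀ β ∈ Icc (0 : ℝ) (9 / 50), μ β ∈ ymGibbsMeasures (d := 4) (fundamentalRep (Fin 2)) β :=
    fun β hβ => hμ β ⟨by linarith [hβ.1], hβ.2⟩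
  have hright := su2_continuousOn_plaquette hμp p
  have hleft_eq : ∀ β ∈ Icc (-(9 / 50) : ℝ) 0,
      -∫ U, plaquetteObs (fundamentalRep (Fin 2)) p.1 p.2.1.1 p.2.1.2 U ∂(μ (-β)) =
        ∫ U, plaquetteObs (fundamentalRep (Fin 2)) p.1 p.2.1.1 p.2.1.2 U ∂(μ β) := fun β hβ => by
    have hb : |(-β)| ≤ 9 / 50 := by rw [abs_neg, abs_of_nonpos hβ.2]; linarith [hβ.1]
    have h := su2_integral_plaquetteObs_neg hb (ν := μ β) (ν' := μ (-β))
      (by rw [neg_neg]; exact hμ β ⟨hβ.1, by linarith [hβ.2]⟩) (hμp (-β) ⟨by linarith [hβ.2], by linarith [hβ.1]⟩) p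
    rw [h]
  have hleft : ContinuousOn (fun β => ∫ U, plaquetteObs (fundamentalRep (Fin 2)) p.1 p.2.1.1 p.2.1.2 U ∂(μ β))
      (Icc (-(9 / 50) : ℝ) 0) := by
    have hc : ContinuousOn
        ((fun β => ∫ U, plaquetteObs (fundamentalRep (Fin 2)) p.1 p.2.1.1 p.2.1.2 U ∂(μ β)) ∘ fun β : ℝ => -β)
        (Icc (-(9 / 50) : ℝ) 0) :=
      hright.comp continuous_neg.continuousOn fun β hβ => ⟨by linarith [hβ.2], by linarith [hβ.1]⟩
    exact hc.neg.congr fun β hβ => (hleft_eq β hβ).symm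
  have h := hleft.union_of_isClosed hright isClosed_Icc isClosed_Icc
  rwa [Icc_union_Icc_eq_Icc (by norm_num) (by norm_num)] at h

/-- ★★ **`SU(2)`, `d = 4`, THE TWO-SIDED WINDOW: the free energy density is differentiable at every `|β| ≤ 9/50`** (within the
closed window; `|β_W| ≤ 9/25`), with derivative `-Σ_{i<j} (2 - ⟨Re tr U_{p_ij}⟩_{μ β})`, along any DLR selection on `[-9/50, 9/50]`. -/
theorem su2_hasDerivWithinAt_freeEnergyDensity_abs
    {μ : ℝ → Measure (LGConfig 4 (Matrix.specialUnitaryGroup (Fin 2) ℂ))}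
    (hμ : ∀ β ∈ Icc (-(9 / 50) : ℝ) (9 / 50), μ β ∈ ymGibbsMeasures (d := 4) (fundamentalRep (Fin 2)) β)
    {β : ℝ} (hβ : β ∈ Icc (-(9 / 50) : ℝ) (9 / 50)) :
    HasDerivWithinAt (freeEnergyDensity 4 (fundamentalRep (Fin 2)))
      (-∑ q : 𝔓₄, ((2 : ℝ) - ∫ U, plaquetteObs (fundamentalRep (Fin 2)) 0 q.1.1 q.1.2 U ∂(μ β)))
      (Icc (-(9 / 50) : ℝ) (9 / 50)) β := by
  haveI := secondCountable_su2_ts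
  have h := hasDerivWithinAt_freeEnergyDensity (d := 4) (fundamentalRep (Fin 2)) (continuous_fundamentalRep _) hμ
    (fun b hb => su2_isZdTranslationInvariant_abs (abs_le.2 ⟨by linarith [hb.1], hb.2⟩) (hμ b hb)) hβ
    fun q => su2_continuousOn_plaquette_abs hμ ((0 : Literature.Probability.LatticeModels.Site 4), q) β hβ
  simpa using h

/-- ★★ **`HasDerivAt` on the open two-sided window `|β| < 9/50`**, in particular AT `β = 0` (two-sided). -/
theorem su2_hasDerivAt_freeEnergyDensity_abs
    {μ : ℝ → Measure (LGConfig 4 (Matrix.specialUnitaryGroup (Fin 2) ℂ))}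
    (hμ : ∀ β ∈ Icc (-(9 / 50) : ℝ) (9 / 50), μ β ∈ ymGibbsMeasures (d := 4) (fundamentalRep (Fin 2)) β)
    {β : ℝ} (hβ : β ∈ Ioo (-(9 / 50) : ℝ) (9 / 50)) :
    HasDerivAt (freeEnergyDensity 4 (fundamentalRep (Fin 2)))
      (-∑ q : 𝔓₄, ((2 : ℝ) - ∫ U, plaquetteObs (fundamentalRep (Fin 2)) 0 q.1.1 q.1.2 U ∂(μ β))) β :=
  (su2_hasDerivWithinAt_freeEnergyDensity_abs hμ (Ioo_subset_Icc_self hβ)).hasDerivAt (Icc_mem_nhds hβ.1 hβ.2)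

/-- ★★ **`f'(0) = -12`, TWO-SIDED**: the free energy density of `SU(2)` lattice Yang–Mills on `ℤ⁴` is differentiable AT `β = 0`
(not only from the right, part 4) with derivative `-12`. -/
theorem su2_hasDerivAt_freeEnergyDensity_zero :
    HasDerivAt (freeEnergyDensity 4 (fundamentalRep (Fin 2))) (-12 : ℝ) 0 := by
  classical
  obtain ⟨ν, hν⟩ := su2_exists_dlrSelection_tree
  have h := su2_hasDerivAt_freeEnergyDensity_abs (fun b _ => hν b) (β := 0) ⟨by norm_num, by norm_num⟩
  have hplaq : ∀ q : 𝔓₄, ∫ U, plaquetteObs (fundamentalRep (Fin 2)) 0 q.1.1 q.1.2 U ∂(ν 0) = 0 := fun q => by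
    rw [integral_plaquetteObs_eq_mul ((0 : Literature.Probability.LatticeModels.Site 4), q) (ν 0),
      su2_plaquette_zero (hν 0) ((0 : Literature.Probability.LatticeModels.Site 4), q), mul_zero]
  simp only [hplaq, sub_zero, Finset.sum_const, Finset.card_univ, nsmul_eq_mul] at h
  have hcard : (Fintype.card 𝔓₄ : ℝ) = 6 := by
    rw [Fintype.card_subtype]; norm_cast
  rw [hcard] at h
  norm_num at h
  exact h

/-- **The two-sided thermodynamic identity**: `f'(β) = -Σ_{i<j} (2 - ⟨Re tr U_{p_ij}⟩_ν)` for every DLR state `ν ∈ 𝒢(β)`,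
every `|β| < 9/50`. -/
theorem su2_deriv_freeEnergyDensity_eq_abs {β : ℝ} (hβ : β ∈ Ioo (-(9 / 50) : ℝ) (9 / 50))
    {ν : Measure (LGConfig 4 (Matrix.specialUnitaryGroup (Fin 2) ℂ))}
    (hν : ν ∈ ymGibbsMeasures (d := 4) (fundamentalRep (Fin 2)) β) :
    deriv (freeEnergyDensity 4 (fundamentalRep (Fin 2))) β =
      -∑ q : 𝔓₄, ((2 : ℝ) - ∫ U, plaquetteObs (fundamentalRep (Fin 2)) 0 q.1.1 q.1.2 U ∂ν) := by
  classical
  obtain ⟨μ, hμ⟩ := su2_exists_dlrSelection_tree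
  have hsel : ∀ t ∈ Icc (-(9 / 50) : ℝ) (9 / 50),
      (fun t => if t = β then ν else μ t) t ∈ ymGibbsMeasures (d := 4) (fundamentalRep (Fin 2)) t := by
    intro t _
    by_cases ht : t = β
    · simp only [ht, if_true]; exact hν
    · simp only [ht, if_false]; exact hμ t
  simpa using (su2_hasDerivAt_freeEnergyDensity_abs hsel hβ).deriv

/-- `f` is differentiable on the open two-sided window. -/
theorem su2_differentiableOn_freeEnergyDensity_abs :
    DifferentiableOn ℝ (freeEnergyDensity 4 (fundamentalRep (Fin 2))) (Ioo (-(9 / 50) : ℝ) (9 / 50)) := by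
  obtain ⟨ν, hν⟩ := su2_exists_dlrSelection_tree
  exact fun β hβ => (su2_hasDerivAt_freeEnergyDensity_abs (fun b _ => hν b) hβ).differentiableAt.differentiableWithinAt

/-- ★ **`f ∈ C¹(-9/50, 9/50)`** — through `β = 0`. -/
theorem su2_contDiffOn_one_freeEnergyDensity_abs :
    ContDiffOn ℝ 1 (freeEnergyDensity 4 (fundamentalRep (Fin 2))) (Ioo (-(9 / 50) : ℝ) (9 / 50)) := by
  obtain ⟨ν, hν⟩ := su2_exists_dlrSelection_tree
  refine CouplingResponse.contDiffOn_one_of_hasDerivAt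
    (fun t ht => su2_hasDerivAt_freeEnergyDensity_abs (fun b _ => hν b) ht) ?_
  exact (continuousOn_finsetSum _ fun q _ => continuousOn_const.sub
    (su2_continuousOn_plaquette_abs (fun b _ => hν b) ((0 : Literature.Probability.LatticeModels.Site 4), q))).neg

/-- **Oddness law for the free energy derivative**: `f'(-β) = -24 - f'(β)` for `|β| < 9/50` (from `⟨Re tr U_p⟩_{-β} = -⟨Re tr U_p⟩_β`;
equivalently `f(-β) = f(β) + 24β`... at the level of derivatives). -/
theorem su2_deriv_freeEnergyDensity_neg {β : ℝ} (hβ : β ∈ Ioo (-(9 / 50) : ℝ) (9 / 50)) :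
    deriv (freeEnergyDensity 4 (fundamentalRep (Fin 2))) (-β) =
      -24 - deriv (freeEnergyDensity 4 (fundamentalRep (Fin 2))) β := by
  obtain ⟨ν, hν⟩ := su2_exists_dlrSelection_tree
  have hβ' : -β ∈ Ioo (-(9 / 50) : ℝ) (9 / 50) := ⟨by linarith [hβ.2], by linarith [hβ.1]⟩
  rw [su2_deriv_freeEnergyDensity_eq_abs hβ' (hν (-β)), su2_deriv_freeEnergyDensity_eq_abs hβ (hν β)]
  have hb : |β| ≤ 9 / 50 := abs_le.2 ⟨hβ.1.le, hβ.2.le⟩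
  have hodd : ∀ q : 𝔓₄, ∫ U, plaquetteObs (fundamentalRep (Fin 2)) 0 q.1.1 q.1.2 U ∂(ν (-β)) =
      -∫ U, plaquetteObs (fundamentalRep (Fin 2)) 0 q.1.1 q.1.2 U ∂(ν β) := fun q =>
    su2_integral_plaquetteObs_neg hb (hν (-β)) (hν β) ((0 : Literature.Probability.LatticeModels.Site 4), q)
  simp only [hodd, sub_neg_eq_add]
  have hcard : (Fintype.card 𝔓₄ : ℝ) = 6 := by
    rw [Fintype.card_subtype]; norm_cast
  have h1 : ∑ q : 𝔓₄, ((2 : ℝ) + ∫ U, plaquetteObs (fundamentalRep (Fin 2)) 0 q.1.1 q.1.2 U ∂(ν β)) +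
      ∑ q : 𝔓₄, ((2 : ℝ) - ∫ U, plaquetteObs (fundamentalRep (Fin 2)) 0 q.1.1 q.1.2 U ∂(ν β)) = 24 := by
    rw [← Finset.sum_add_distrib, Finset.sum_congr rfl fun q _ => show _ = (4 : ℝ) by ring, Finset.sum_const,
      Finset.card_univ, nsmul_eq_mul, hcard]
    norm_num
  linarith

/-- ★★ **`f''(0) = 6` TWO-SIDED: the derivative `f'` of the free energy density is differentiable AT `β = 0` with
`(f')'(0) = 6`** (`= #planes · N² · Var_{Haar}(W_p) = 6 · 4 · (1/4)`): the right derivative of the energy density at `0⁺` is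
`Σ_{i<j} d/dβ ⟨Re tr U_p⟩ = 6 · (2 · 2 · u'(0⁺)) = 6` (part 4, `u'(0⁺) = 1/4` in `β_W = 2β`), and by oddness the left derivative is
the same. In Wilson's normalisation `g(β_W) = f(β_W/2)`: `g''(0) = 3/2`, `g(β_W) = -6β_W + (3/4)β_W² + o(β_W²)` two-sidedly. -/
theorem su2_hasDerivAt_deriv_freeEnergyDensity_zero :
    HasDerivAt (deriv (freeEnergyDensity 4 (fundamentalRep (Fin 2)))) (6 : ℝ) 0 := by
  classical
  obtain ⟨μ, hμ⟩ := CouplingResponse.exists_dlrSelection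
  -- the tree selection and the energy density along it
  set ν : ℝ → Measure (LGConfig 4 (Matrix.specialUnitaryGroup (Fin 2) ℂ)) := fun β => μ (2 * β) with hν
  have hνsel : ∀ β : ℝ, ν β ∈ ymGibbsMeasures (d := 4) (fundamentalRep (Fin 2)) β := fun β => by
    have h := hμ (2 * β)
    rwa [show (2 : ℝ) * (2 * β / 4) = β by ring] at h
  have hμW : ∀ βW ∈ Icc (0 : ℝ) (9 / 25), μ βW ∈ ymGibbsMeasures (d := 4) (fundamentalRep (Fin 2)) (2 * (βW / 4)) :=
    fun βW _ => hμ βW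
  set E : ℝ → ℝ := fun t => -∑ q : 𝔓₄, ((2 : ℝ) - ∫ U, plaquetteObs (fundamentalRep (Fin 2)) 0 q.1.1 q.1.2 U ∂(ν t))
    with hE
  -- (i) `deriv f = E` on the open two-sided window
  have hfE : deriv (freeEnergyDensity 4 (fundamentalRep (Fin 2))) =ᶠ[𝓝 0] E := by
    filter_upwards [Ioo_mem_nhds (show (-(9 / 50) : ℝ) < 0 by norm_num) (show (0 : ℝ) < 9 / 50 by norm_num)] with t ht
    exact su2_deriv_freeEnergyDensity_eq_abs ht (hνsel t)
  -- (ii) right derivative of each plane term: d/dt ∫ Re tr U_q ∂(ν t) = 2 · (2 · 1/4) = 1 at 0⁺ (tree coupling)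
  have hplane : ∀ q : 𝔓₄, HasDerivWithinAt (fun t => ∫ U, plaquetteObs (fundamentalRep (Fin 2)) 0 q.1.1 q.1.2 U ∂(ν t))
      (1 : ℝ) (Icc (0 : ℝ) (9 / 50)) 0 := fun q => by
    have hW := su2_hasDerivWithinAt_plaquette_zero hμW ((0 : Literature.Probability.LatticeModels.Site 4), q)
    have hinner : HasDerivWithinAt (fun t : ℝ => 2 * t) (2 : ℝ) (Icc (0 : ℝ) (9 / 50)) 0 := by
      simpa using ((hasDerivAt_id (0 : ℝ)).const_mul (2 : ℝ)).hasDerivWithinAt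
    have hW' : HasDerivWithinAt (fun s => ∫ U, zdPlaquetteObs (fundamentalRep (Fin 2)) 0 q.1.1 q.1.2 U ∂(μ s))
        (1 / 4 : ℝ) (Icc (0 : ℝ) (9 / 25)) ((fun t : ℝ => 2 * t) 0) := by
      rw [show (fun t : ℝ => 2 * t) 0 = 0 by norm_num]; exact hW
    have hmaps : MapsTo (fun t : ℝ => 2 * t) (Icc (0 : ℝ) (9 / 50)) (Icc (0 : ℝ) (9 / 25)) :=
      fun t ht => ⟨by linarith [ht.1], by linarith [ht.2]⟩
    have hcomp := HasDerivWithinAt.comp (0 : ℝ) hW' hinner hmaps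
    have hscale : (fun t => ∫ U, plaquetteObs (fundamentalRep (Fin 2)) 0 q.1.1 q.1.2 U ∂(ν t)) =
        fun t => 2 * ((fun s => ∫ U, zdPlaquetteObs (fundamentalRep (Fin 2)) 0 q.1.1 q.1.2 U ∂(μ s)) ∘
          fun t : ℝ => 2 * t) t := by
      funext t
      simp only [Function.comp_def, hν]
      exact_mod_cast integral_plaquetteObs_eq_mul ((0 : Literature.Probability.LatticeModels.Site 4), q) (μ (2 * t))
    rw [hscale]
    refine (hcomp.const_mul 2).congr_deriv ?_
    norm_num
  -- (iii) right derivative of `E` at `0`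
  have hright : HasDerivWithinAt E (6 : ℝ) (Icc (0 : ℝ) (9 / 50)) 0 := by
    have h := HasDerivWithinAt.fun_sum (u := (Finset.univ : Finset 𝔓₄)) fun q _ =>
      ((hasDerivWithinAt_const (0 : ℝ) (Icc (0 : ℝ) (9 / 50)) (2 : ℝ)).sub (hplane q))
    refine h.fun_neg.congr_deriv ?_
    have hcard : (Fintype.card 𝔓₄ : ℝ) = 6 := by
      rw [Fintype.card_subtype]; norm_cast
    rw [Finset.sum_const, Finset.card_univ, nsmul_eq_mul, hcard]
    norm_num
  -- (iv) left derivative of `E` at `0`: on `[-9/50, 0]`, `E(t) = -Σ (2 + ∫ Re tr U_q ∂(ν (-t)))`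
  have hleft : HasDerivWithinAt E (6 : ℝ) (Icc (-(9 / 50) : ℝ) 0) 0 := by
    have hneg : HasDerivWithinAt (fun t : ℝ => -t) (-1 : ℝ) (Icc (-(9 / 50) : ℝ) 0) 0 := by
      simpa using (hasDerivAt_neg (0 : ℝ)).hasDerivWithinAt
    have hplane' : ∀ q : 𝔓₄, HasDerivWithinAt
        (fun t => ∫ U, plaquetteObs (fundamentalRep (Fin 2)) 0 q.1.1 q.1.2 U ∂(ν (-t))) (-1 : ℝ)
        (Icc (-(9 / 50) : ℝ) 0) 0 := fun q => by
      have hp' : HasDerivWithinAt (fun t => ∫ U, plaquetteObs (fundamentalRep (Fin 2)) 0 q.1.1 q.1.2 U ∂(ν t))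
          (1 : ℝ) (Icc (0 : ℝ) (9 / 50)) ((fun t : ℝ => -t) 0) := by
        rw [show (fun t : ℝ => -t) 0 = 0 by norm_num]; exact hplane q
      have hmaps : MapsTo (fun t : ℝ => -t) (Icc (-(9 / 50) : ℝ) 0) (Icc (0 : ℝ) (9 / 50)) :=
        fun t ht => ⟨by linarith [ht.2], by linarith [ht.1]⟩
      have hcomp := HasDerivWithinAt.comp (0 : ℝ) hp' hneg hmaps
      simpa [Function.comp_def] using hcomp
    have h := HasDerivWithinAt.fun_sum (u := (Finset.univ : Finset 𝔓₄)) fun q _ =>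
      ((hasDerivWithinAt_const (0 : ℝ) (Icc (-(9 / 50) : ℝ) 0) (2 : ℝ)).add (hplane' q))
    have h' : HasDerivWithinAt
        (fun t => -∑ q : 𝔓₄, ((2 : ℝ) + ∫ U, plaquetteObs (fundamentalRep (Fin 2)) 0 q.1.1 q.1.2 U ∂(ν (-t))))
        (6 : ℝ) (Icc (-(9 / 50) : ℝ) 0) 0 := by
      refine h.fun_neg.congr_deriv ?_
      have hcard : (Fintype.card 𝔓₄ : ℝ) = 6 := by
        rw [Fintype.card_subtype]; norm_cast
      rw [Finset.sum_const, Finset.card_univ, nsmul_eq_mul, hcard]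
      norm_num
    -- the two expressions agree on `[-9/50, 0]` (oddness), including at `0`
    have hEq : ∀ t ∈ Icc (-(9 / 50) : ℝ) 0,
        -∑ q : 𝔓₄, ((2 : ℝ) + ∫ U, plaquetteObs (fundamentalRep (Fin 2)) 0 q.1.1 q.1.2 U ∂(ν (-t))) = E t := by
      intro t ht
      have hb : |(-t)| ≤ 9 / 50 := by rw [abs_neg, abs_of_nonpos ht.2]; linarith [ht.1]
      simp only [hE]
      congr 1
      refine Finset.sum_congr rfl fun q _ => ?_
      rw [su2_integral_plaquetteObs_neg hb (ν := ν t) (ν' := ν (-t)) (by rw [neg_neg]; exact hνsel t) (hνsel (-t))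
        ((0 : Literature.Probability.LatticeModels.Site 4), q)]
      ring
    exact h'.congr (fun t ht => (hEq t ht).symm) (hEq 0 ⟨by norm_num, le_rfl⟩).symm
  -- (v) glue
  have hboth := hleft.union hright
  rw [Icc_union_Icc_eq_Icc (by norm_num) (by norm_num)] at hboth
  exact (hboth.hasDerivAt (Icc_mem_nhds (by norm_num) (by norm_num))).congr_of_eventuallyEq hfE

end TwoSided

end Summit.Ventures.YMGap.PressureRegularity

end
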